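import Literature.NumberTheory.GaloisRepresentations.LocalGlobalCohomologyDualityProofs
import Mathlib.LinearAlgebra.TensorProduct.Basic
import Mathlib.Algebra.Module.ZMod
import HarnessLib

/-!
# Frobenioids II, Def. 2.2 (ii): `H_A^ab ⊗ F_N(A) ⥲ Hom(Hom(H_A, ℤ/Nℤ), F_N(A))` for `H_A` finite,
# `F_N(A) ≅ ℤ/Nℤ` (the finite-group algebra behind "the isomorphism induced by the cup product")

Mochizuki, *The geometry of Frobenioids II*, Kyushu J. Math. **62** (2008) 401–460, §2, Def. 2.2 (ii)
p. 18 [cite: MochizukiFrdII2008, Def 2.2 p.18]: "the cup product on group cohomology … determines an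
isomorphism `H¹(H, μ_N(A)) ⥲ H^ab ⊗ H²(H, μ_N(A))` … we obtain a natural isomorphism
`H¹(H_A, μ_N(A)) ⥲ H_A^ab ⊗ F_N(A)`". The cup product lands in `Hom(H¹(H_A, ℤ/Nℤ), F_N(A)) =
Hom(Hom(H_A^ab, ℤ/Nℤ), F_N(A))`; reading it in `H_A^ab ⊗ F_N(A)` goes through the tautological map
`θ : H_A^ab ⊗ F_N(A) → Hom(Hom(H_A^ab, ℤ/N), F_N(A))`, `a ⊗ φ ↦ (χ ↦ χ(a) · φ)` (abc-iut-L2-t12's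
`Kummer.thetaHom`, row L1-γ₁), which is bijective because `H_A` is FINITE and `F_N(A) ≅ ℤ/Nℤ`
([NSW] 7.2.6). This PROOF-ONLY file (abc-iut-L1-t7) supplies that bijectivity as pure finite-abelian-group
algebra, for ANY additive map `θ` satisfying the defining formula on pure tensors (so that it applies
verbatim to `Kummer.thetaHom` once that file is in the tree):

* `Kummer.exists_eval_eq_of_addMonoidHom_zmod` — double duality, additive form: every additive
  functional on the `ℤ/N`-valued character group of a finite abelian group killed by `N` is an
  evaluation (from the trunk's finite duality `AddMonoidHom.bijective_of_bijective_flip`,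
  `exists_addMonoidHom_zmod_apply_ne_zero`, `LocalGlobalCohomologyDualityProofs.lean`, themselves
  from Mathlib's `CommGroup` duality with values in `Multiplicative (ℤ/N)`);
* **`Kummer.tensorEval_bijective`** (with `tensorEval_eq_zero`, `tensorEval_surjective`) — for
  `M` finite abelian, `C ≅ ℤ/Nℤ` (`N ≥ 1`) and `θ : M ⊗ C →+ Hom(Hom(M, ℤ/N), C)` with
  `θ(m ⊗ c)(χ) = χ(m) · c`: `θ` is bijective (trivial kernel: every tensor is `m ⊗ c₀` and
  `χ(m) = 0 ∀χ` forces `m ∈ N·M`; surjective: double duality for `M/N·M`).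
No definitions; classical algebra; nothing here concerns [IUTchIII].

PROVENANCE: this is abc-iut-L1-t7 (gen 3)'s file p413374 (ACCEPTED at
`Frobenioids/KummerThetaBijective.lean`, commit 7cb27192b059) byte-identical below this docstring,
re-landed at the present path by abc-iut-L2-t12 because the later whole-file proposal p413540
(abc-iut-L2-t12's `ZModDuality.*` / `Kummer.thetaHom_bijective`, filed while p413374 was pending)
replaced that file and removed these eight declarations (gate note "removes 8 declaration(s)
nothing references (allowed, recorded)"). Both forms now live in the tree: the generic
`Kummer.tensorEval_bijective` here, its instance `Kummer.thetaHom_bijective` there.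
-/

namespace Literature.AlgebraicGeometry.Frobenioids

namespace Kummer

open scoped TensorProduct

/-! ### Double duality for finite abelian groups killed by `N`, additive form -/

section Additive

open Literature.NumberTheory.GaloisRepresentations

variable {V : Type*} [AddCommGroup V] [Finite V] {N : ℕ} [NeZero N] (hV : ∀ v : V, N • v = 0)

include hV in
/-- **Double duality, additive form**: every additive functional on the group of `ℤ/N`-valued
characters of a finite abelian group `V` killed by `N` is evaluation at an element of `V` (the
evaluation map `V → Hom(Hom(V, ℤ/N), ℤ/N)` is bijective: its flip is the identity of `Hom(V, ℤ/N)`,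
`AddMonoidHom.bijective_of_bijective_flip`). [cite: MochizukiFrdII2008, Def 2.2 p.18] -/
theorem exists_eval_eq_of_addMonoidHom_zmod (η : (V →+ ZMod N) →+ ZMod N) :
    ∃ v : V, ∀ χ : V →+ ZMod N, η χ = χ v := by
  have hX : ∀ χ : V →+ ZMod N, N • χ = 0 := fun χ => by
    ext v
    rw [AddMonoidHom.nsmul_apply, nsmul_eq_mul, ZMod.natCast_self, zero_mul,
      AddMonoidHom.zero_apply]
  have hflip : Function.Bijective (AddMonoidHom.eval : V →+ (V →+ ZMod N) →+ ZMod N).flip := by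
    have hid : (AddMonoidHom.eval : V →+ (V →+ ZMod N) →+ ZMod N).flip = AddMonoidHom.id _ :=
      AddMonoidHom.ext fun χ => AddMonoidHom.ext fun v => rfl
    rw [hid]
    exact Function.bijective_id
  obtain ⟨v, hv⟩ :=
    (AddMonoidHom.bijective_of_bijective_flip hV hX AddMonoidHom.eval hflip).1.2 η
  exact ⟨v, fun χ => by rw [← hv]; rfl⟩

end Additive

/-! ### The tautological map `M ⊗ C → Hom(Hom(M, ℤ/N), C)` is bijective -/

section Theta

variable {M : Type*} [AddCommGroup M] [Finite M] {C : Type*} [AddCommGroup C] {N : ℕ} [NeZero N]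
  [Module (ZMod N) C] (e : C ≃+ ZMod N)
  (θ : M ⊗[ℤ] C →+ ((M →+ ZMod N) →+ C))
  (hθ : ∀ (m : M) (c : C) (χ : M →+ ZMod N), θ (m ⊗ₜ c) χ = χ m • c)

omit [Finite M] [NeZero N] in
/-- `N` kills every `ℤ/N`-valued character value of an `N`-th multiple: `χ (N • m) = 0`.
[cite: MochizukiFrdII2008, Def 2.2 p.18] -/
theorem addMonoidHom_zmod_apply_nsmul (χ : M →+ ZMod N) (m : M) : χ (N • m) = 0 := by
  rw [map_nsmul, nsmul_eq_mul, ZMod.natCast_self, zero_mul]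

omit [NeZero N] [Module (ZMod N) C] in
include e in
/-- `N` kills `C ≅ ℤ/N`. [cite: MochizukiFrdII2008, Def 2.2 p.18] -/
theorem nsmul_eq_zero_of_equiv (c : C) : N • c = 0 := by
  apply e.injective
  rw [map_nsmul, map_zero, nsmul_eq_mul, ZMod.natCast_self, zero_mul]

omit [Module (ZMod N) C] in
include e in
/-- Every element of `C ≅ ℤ/N` is a natural multiple of `c₀ := e⁻¹(1)`.
[cite: MochizukiFrdII2008, Def 2.2 p.18] -/
theorem exists_nsmul_generator (c : C) : ∃ k : ℕ, c = k • e.symm 1 := by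
  refine ⟨(e c).val, e.injective ?_⟩
  rw [map_nsmul, e.apply_symm_apply, nsmul_eq_mul, mul_one, ZMod.natCast_zmod_val]

omit [Finite M] [Module (ZMod N) C] in
include e in
/-- Every element of `M ⊗ C` (`C ≅ ℤ/N` cyclic) is a pure tensor `m ⊗ e⁻¹(1)`.
[cite: MochizukiFrdII2008, Def 2.2 p.18] -/
theorem exists_eq_tmul_generator (t : M ⊗[ℤ] C) : ∃ m : M, t = m ⊗ₜ e.symm 1 := by
  induction t using TensorProduct.induction_on with
  | zero => exact ⟨0, (TensorProduct.zero_tmul M (e.symm 1)).symm⟩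
  | tmul m c =>
    obtain ⟨k, rfl⟩ := exists_nsmul_generator e c
    refine ⟨k • m, ?_⟩
    rw [← natCast_zsmul, ← natCast_zsmul, TensorProduct.smul_tmul]
  | add x y hx hy =>
    obtain ⟨m, rfl⟩ := hx
    obtain ⟨m', rfl⟩ := hy
    exact ⟨m + m', (TensorProduct.add_tmul m m' _).symm⟩

include hθ e in
/-- **Injectivity**: if `θ(t) = 0` then `t = 0` — writing `t = m ⊗ c₀`, all characters vanish on `m`,
so `m ∈ N · M` (characters of `M/N·M` separate points) and `m ⊗ c₀ = m′ ⊗ N c₀ = 0`.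
[cite: MochizukiFrdII2008, Def 2.2 p.18] -/
theorem tensorEval_eq_zero (t : M ⊗[ℤ] C) (ht : θ t = 0) : t = 0 := by
  obtain ⟨m, rfl⟩ := exists_eq_tmul_generator e t
  -- all characters vanish on `m`
  have hχ : ∀ χ : M →+ ZMod N, χ m = 0 := fun χ => by
    have h := congrArg (fun Φ : (M →+ ZMod N) →+ C => e (Φ χ)) ht
    simp only [hθ, AddMonoidHom.zero_apply, map_zero] at h
    rwa [ZMod.map_smul, e.apply_symm_apply, smul_eq_mul, mul_one] at h
  -- hence `m ∈ N · M`: characters of `M ⧸ N·M` separate points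
  let NM : AddSubgroup M := (nsmulAddMonoidHom N : M →+ M).range
  have hV : ∀ v : M ⧸ NM, N • v = 0 := fun v => by
    induction v using QuotientAddGroup.induction_on with
    | H x => rw [← QuotientAddGroup.mk_nsmul, QuotientAddGroup.eq_zero_iff]; exact ⟨x, rfl⟩
  have hm : (m : M ⧸ NM) = 0 := by
    by_contra hne
    obtain ⟨χ, hχ'⟩ :=
      Literature.NumberTheory.GaloisRepresentations.exists_addMonoidHom_zmod_apply_ne_zero hV hne
    exact hχ' (hχ (χ.comp (QuotientAddGroup.mk' NM)))
  obtain ⟨m', hm'⟩ := (QuotientAddGroup.eq_zero_iff m).mp hm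
  -- so `m ⊗ c₀ = m′ ⊗ N c₀ = 0`
  rw [← hm']
  change (N • m') ⊗ₜ[ℤ] e.symm 1 = 0
  rw [← natCast_zsmul, TensorProduct.smul_tmul, natCast_zsmul, nsmul_eq_zero_of_equiv e,
    TensorProduct.tmul_zero]

include hθ e in
/-- **Surjectivity**: every `Φ : Hom(M, ℤ/N) → C` is `θ(m ⊗ c₀)` — `e ∘ Φ` is an additive functional
on the characters of `M/N·M`, hence evaluation at some `m` (double duality).
[cite: MochizukiFrdII2008, Def 2.2 p.18] -/
theorem tensorEval_surjective : Function.Surjective θ := by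
  intro Φ
  let NM : AddSubgroup M := (nsmulAddMonoidHom N : M →+ M).range
  have hV : ∀ v : M ⧸ NM, N • v = 0 := fun v => by
    induction v using QuotientAddGroup.induction_on with
    | H x => rw [← QuotientAddGroup.mk_nsmul, QuotientAddGroup.eq_zero_iff]; exact ⟨x, rfl⟩
  -- characters of `M` factor through `M ⧸ N·M`
  have hker : ∀ χ : M →+ ZMod N, NM ≤ χ.ker := fun χ => by
    rintro _ ⟨x, rfl⟩
    exact addMonoidHom_zmod_apply_nsmul χ x
  -- `η := e ∘ Φ ∘ (− ∘ mk)` on characters of the quotient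
  let η : (M ⧸ NM →+ ZMod N) →+ ZMod N :=
    { toFun := fun ψ => e (Φ (ψ.comp (QuotientAddGroup.mk' NM)))
      map_zero' := by rw [AddMonoidHom.zero_comp, map_zero, map_zero]
      map_add' := fun ψ ψ' => by rw [AddMonoidHom.add_comp, map_add, map_add] }
  obtain ⟨v, hv⟩ := exists_eval_eq_of_addMonoidHom_zmod hV η
  obtain ⟨m, rfl⟩ := QuotientAddGroup.mk_surjective v
  refine ⟨m ⊗ₜ e.symm 1, AddMonoidHom.ext fun χ => ?_⟩
  rw [hθ]
  have hfac : (QuotientAddGroup.lift NM χ (hker χ)).comp (QuotientAddGroup.mk' NM) = χ :=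
    AddMonoidHom.ext fun x => rfl
  have h := hv (QuotientAddGroup.lift NM χ (hker χ))
  change e (Φ ((QuotientAddGroup.lift NM χ (hker χ)).comp (QuotientAddGroup.mk' NM))) = χ m at h
  rw [hfac] at h
  apply e.injective
  rw [ZMod.map_smul, e.apply_symm_apply, smul_eq_mul, mul_one, h]

include hθ e in
/-- **`θ : M ⊗ C ⥲ Hom(Hom(M, ℤ/N), C)` is bijective** for `M` finite and `C ≅ ℤ/Nℤ` — the
finite-group algebra behind "`H¹(H_A, μ_N(A)) ⥲ H_A^ab ⊗ F_N(A)` induced by the cup product"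
(`M = H_A^ab`, `C = F_N(A) ≅ ℤ/Nℤ`, [NSW] 7.2.6). [cite: MochizukiFrdII2008, Def 2.2 p.18] -/
theorem tensorEval_bijective : Function.Bijective θ :=
  ⟨(injective_iff_map_eq_zero θ).mpr (tensorEval_eq_zero e θ hθ), tensorEval_surjective e θ hθ⟩

end Theta

end Kummer

end Literature.AlgebraicGeometry.Frobenioids
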